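import Mathlib
import Literature.Analysis.FluidPDE.PeriodicBoundedMildTorus
import Literature.Analysis.FluidPDE.NSCoriolisTorus
import Literature.Analysis.FunctionSpaces.TorusFluidGlueProofs
import Summits.NavierStokesRegularity.NavierStokesRegularity.Theorems.TypeILiouvilleLatticeMomentum
import Summits.NavierStokesRegularity.NavierStokesRegularity.Theorems.TypeILiouvilleStrainLedgerExtinction
import Summits.NavierStokesRegularity.NavierStokesRegularity.Theorems.TypeILiouvilleTypeIliouvilleLStubOseenConstBoost

/-!
# TypeILiouvilleLatticeLiouville — crux (L) stmt-NavierStokesRegularity-10661 `TypeIliouvilleL`: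
# THE SPATIALLY PERIODIC SIEVE — every `ℤ³`-periodic member of print's class P is one constant vector

Helper for stmt-NavierStokesRegularity-10661 (`--supports`); theorems only, no definitions, no named-fact
hypotheses; closes no item; Navier–Stokes regularity is NOT proved here (leafhand seat of the
EulerZoomLiouville route, LAND-ONLY).

Class P = print's class of bounded ancient mild solutions (KNSS 2009 §4 (i); binders of the registered stubs
`stub_quiescentLiouville` / `stub_persistent_mild_backward_L3_recurrence` verbatim): `v : ℝ → ℝ³ → ℝ³`
continuous and bounded on `(−∞,0) × ℝ³`, weakly divergence-free slices, Oseen integral equation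
`v(t) = e^{(t−s)Δ}v(s) − B¹_s(v,v)(t)` for all `s < t < 0`.

* `classP_torus_unforced_of_isLatticePeriodic_zeroMean` — a `ℤ³`-periodic class-P member with ZERO cell mean
  on every slice is, read on the flat torus `ℝ³/ℤ³`, an UNFORCED classical Navier–Stokes solution on every
  window `(t₀,0)`: class P is classical (`TypeILiouvilleStrainLedger.classP_exists_isClassicalNSSolutionOn_Ioo`),
  the whole-space pressure gradient is periodic, so `p = θ + ⟪c(t),·⟫` with `θ` periodic; the system with the
  constant force `−c(t)` descends to the torus (`IsClassicalNSSolutionOn.to_torus_holds`), where the mean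
  velocity moves by the mean force (`Torus.IsClassicalNSSolutionOn.hasDerivWithinAt_integral_velocity`) — but the
  cell mean is conserved (`TypeILiouvilleLatticeMomentum.classP_cellMean_eq_of_isLatticePeriodic`), hence
  `c ≡ 0` (the argument of `Literature.Analysis.FluidPDE.Torus.exists_classicalNS_of_bounded_data`, KNSS 2009 §3
  p. 6: the drift ambiguity of `L^∞` solutions is absent for mild ones).
* `torus_kineticEnergy_decay_of_zeroMean` — Poincaré/energy decay on `𝕋³` for an unforced classical solution
  whose slices have zero mean: `½‖V(t)‖² ≤ ½‖V(s)‖² e^{−8π²(t−s)}` (BMN 1999 Remark 5.2; tree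
  `Torus.integral_norm_sq_le_gradNormSq_of_hasZeroMean`, `Torus.IsClassicalNSSolutionOn.energy_balance_holds`).
* `classP_const_of_isLatticePeriodic` — **THE PERIODIC SIEVE: a class-P member whose slices are
  `ℤ³`-periodic is one constant vector `b`** (`v(t,x) = b` for all `t < 0`, `x`): Galilean boost by the
  conserved cell mean (`Theorems.stub_oseen_const_boost`) to zero mean, then the energy decay run backwards
  from `s → −∞` against the uniform bound forces zero energy on every slice.

READING for (L) / L_Q: the spatially periodic stratum of the registered stubs is EMPTY of non-constant
members (stratum kill; the census's ancient rows carry axially periodic axisymmetric members — Lei–Ren–Zhang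
2019 — but not the triply periodic class).  [cite: KochNadirashviliSereginSverak2009, §3 p. 6, §4 p. 8, Remark 6.1 (arXiv:0709.3599)];
[cite: BabinMahalovNicolaenko1999, Remark 5.2]; [cite: Grafakos2014, §3.1.1]
-/

noncomputable section
open MeasureTheory Filter Set Function Metric InnerProductSpace
open scoped Topology RealInnerProductSpace Laplacian ContDiff
open Literature.Analysis Literature.Analysis.FunctionSpaces Literature.Analysis.FluidPDE
set_option linter.dupNamespace false
namespace Summit.NavierStokesRegularity.NavierStokesRegularity.Theorems.TypeILiouvilleLatticeMomentum

/-! ## §1 Energy decay on the torus for zero-mean unforced classical solutions -/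

/-- **Poincaré/energy decay on `𝕋³`** (BMN 1999, Remark 5.2, with `F = 0`, `Ω = 0`): for an unforced
classical solution on a convex time set all of whose slices have zero mean,
`½‖V(t)‖² ≤ ½‖V(s)‖² · e^{−8π²ν(t−s)}` for `s ≤ t` (energy balance `d/dt ½‖V‖² = −ν‖∇V‖₂²` and the
Poincaré inequality `4π²∫‖V‖² ≤ ‖∇V‖₂²` for zero-mean slices; Gronwall). [cite: BabinMahalovNicolaenko1999, Remark 5.2] -/
theorem torus_kineticEnergy_decay_of_zeroMean {S : Set ℝ} {ν : ℝ}
    {V : ℝ → UnitAddTorus (Fin 3) → EuclideanSpace ℝ (Fin 3)} {Θ : ℝ → UnitAddTorus (Fin 3) → ℝ}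
    (h : Torus.IsClassicalNSSolutionOn S ν 0 V Θ) (hν : 0 ≤ ν) (hS : Convex ℝ S)
    (h0 : ∀ τ ∈ S, Torus.HasZeroMean (V τ)) {s t : ℝ} (hs : s ∈ S) (ht : t ∈ S) (hst : s ≤ t) :
    Torus.kineticEnergy (V t) ≤
      Torus.kineticEnergy (V s) * Real.exp (-(8 * Real.pi ^ 2 * ν * (t - s))) := by
  set c : ℝ := 8 * Real.pi ^ 2 * ν with hc
  set E : ℝ → ℝ := fun τ => Torus.kineticEnergy (V τ) with hE
  have hdE : ∀ τ ∈ S, HasDerivWithinAt E (-ν * Torus.gradNormSq (V τ)) S τ := by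
    intro τ hτ
    have h1 := Torus.IsClassicalNSSolutionOn.energy_balance_holds h hS hτ
    simpa only [Pi.zero_apply, inner_zero_left, integral_zero, add_zero] using h1
  have hP : ∀ τ ∈ S, 8 * Real.pi ^ 2 * E τ ≤ Torus.gradNormSq (V τ) := by
    intro τ hτ
    have hsm : Torus.IsSmooth (V τ) := h.smooth_velocity.isSmooth_slice hτ
    have hP' := Torus.integral_norm_sq_le_gradNormSq_of_hasZeroMean hsm (h0 τ hτ)
    calc 8 * Real.pi ^ 2 * E τ = 4 * Real.pi ^ 2 * ∫ x, ‖V τ x‖ ^ 2 := by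
          simp only [hE, Torus.kineticEnergy]; ring
      _ ≤ _ := hP'
  have hdg : ∀ τ ∈ S, HasDerivWithinAt (fun σ => Real.exp (c * σ) * E σ)
      (Real.exp (c * τ) * (c * E τ - ν * Torus.gradNormSq (V τ))) S τ := by
    intro τ hτ
    have h1 : HasDerivAt (fun σ => Real.exp (c * σ)) (Real.exp (c * τ) * c) τ := by
      simpa using ((hasDerivAt_id τ).const_mul c).exp
    refine ((h1.hasDerivWithinAt (s := S)).mul (hdE τ hτ)).congr_deriv ?_
    ring
  have hg0 : ∀ τ ∈ S,
      Real.exp (c * τ) * (c * E τ - ν * Torus.gradNormSq (V τ)) ≤ 0 := by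
    intro τ hτ
    refine mul_nonpos_iff.2 (Or.inl ⟨Real.exp_nonneg _, ?_⟩)
    have e1 : c * E τ - ν * Torus.gradNormSq (V τ) =
        ν * (8 * Real.pi ^ 2 * E τ - Torus.gradNormSq (V τ)) := by
      rw [hc]; ring
    rw [e1]
    exact mul_nonpos_iff.2 (Or.inl ⟨hν, by linarith [hP τ hτ]⟩)
  have hanti : AntitoneOn (fun σ => Real.exp (c * σ) * E σ) S :=
    antitoneOn_of_hasDerivWithinAt_nonpos hS (fun τ hτ => (hdg τ hτ).continuousWithinAt)
      (fun τ hτ => (hdg τ (interior_subset hτ)).mono interior_subset)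
      (fun τ hτ => hg0 τ (interior_subset hτ))
  have h3 : Real.exp (c * t) * E t ≤ Real.exp (c * s) * E s := hanti hs ht hst
  have h4 : E t ≤ Real.exp (c * s) * E s / Real.exp (c * t) :=
    (le_div_iff₀' (Real.exp_pos _)).2 h3
  calc E t ≤ Real.exp (c * s) * E s / Real.exp (c * t) := h4
    _ = E s * Real.exp (c * s - c * t) := by rw [Real.exp_sub]; ring
    _ = E s * Real.exp (-(c * (t - s))) := by congr 1; congr 1; ring

/-! ## §2 Periodic zero-mean members of class P are unforced torus solutions -/

/-- **A `ℤ³`-periodic class-P member with zero cell mean is, on the torus, an UNFORCED classical solution on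
every window `(t₀, 0)`** — with the torus velocity `W t x = w t (repr x)` (so `lift (W t) = w t`).  The
whole-space pressure of the classical representation has a periodic gradient, hence a linear part
`⟪c(t),·⟫`; descending with the constant force `−c(t)`, the torus mean velocity has derivative `−c(t)`, and
it is constant (zero) by hypothesis, so `c ≡ 0`. [cite: KochNadirashviliSereginSverak2009, §3 p. 6 and §4 p. 8 (arXiv:0709.3599)] -/
theorem classP_torus_unforced_of_isLatticePeriodic_zeroMean
    {w : ℝ → EuclideanSpace ℝ (Fin 3) → EuclideanSpace ℝ (Fin 3)}
    (hc : ContinuousOn (uncurry w) (Iio 0 ×ˢ univ))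
    (hK : ∃ K : ℝ, ∀ t < 0, ∀ x, ‖w t x‖ ≤ K)
    (hd : ∀ t < 0, IsWeaklyDivFree (w t))
    (hm : ∀ s t : ℝ, s < t → t < 0 → ∀ x,
      w t x = UnboundedOperators.heatExtension (w s) (t - s) x - oseenDuhamel 1 s w w t x)
    (hper : ∀ t < 0, Torus.IsLatticePeriodic (w t))
    (hmean : ∀ t < 0, ∫ x in Torus.unitCube (Fin 3), w t x = 0) {t₀ : ℝ} (ht₀ : t₀ < 0) :
    ∃ Θ : ℝ → UnitAddTorus (Fin 3) → ℝ,
      Torus.IsClassicalNSSolutionOn (Ioo t₀ 0) 1 0 (fun t x => w t (Torus.repr x)) Θ := by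
  obtain ⟨p, hcl⟩ :=
    TypeILiouvilleStrainLedger.classP_exists_isClassicalNSSolutionOn_Ioo hc hK hd hm ht₀
  have hSU : UniqueDiffOn ℝ (Ioo t₀ (0 : ℝ)) := isOpen_Ioo.uniqueDiffOn
  have hSneg : ∀ t ∈ Ioo t₀ (0 : ℝ), t < 0 := fun t ht => ht.2
  -- periodicity of the velocity on the window
  have hperj : ∀ t ∈ Ioo t₀ (0 : ℝ), ∀ (j : Fin 3) (y : EuclideanSpace ℝ (Fin 3)),
      w t (y + EuclideanSpace.single j 1) = w t y := fun t ht j y => hper t ht.2 j y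
  -- the torus velocity
  set V : ℝ → UnitAddTorus (Fin 3) → EuclideanSpace ℝ (Fin 3) := fun t x => w t (Torus.repr x) with hVdef
  have hVlift : ∀ t < 0, Torus.lift (V t) = w t := fun t ht => Torus.lift_descend_holds (w t) (hper t ht)
  -- the pressure gradient is periodic
  have hmomR : ∀ t ∈ Ioo t₀ (0 : ℝ), ∀ y, gradient (p t) y =
      (1 : ℝ) • (Δ (w t)) y - timeDerivWithin (Ioo t₀ 0) w t y - convect (w t) (w t) y := by
    intro t ht y
    have h1 := hcl.momentum t ht y
    simp only [Pi.zero_apply, add_zero] at h1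
    rw [sub_sub, h1, sub_sub_cancel]
  have hgradper : ∀ t ∈ Ioo t₀ (0 : ℝ), ∀ (j : Fin 3) (y : EuclideanSpace ℝ (Fin 3)),
      gradient (p t) (y + EuclideanSpace.single j 1) = gradient (p t) y := by
    intro t ht j y
    have hfun : (fun x => w t (x + EuclideanSpace.single j 1)) = w t := funext (hperj t ht j)
    have h1 : (Δ (w t)) (y + EuclideanSpace.single j 1) = (Δ (w t)) y := by
      rw [← Torus.laplacian_comp_add_right (w t) (EuclideanSpace.single j 1) y, hfun]
    have h2 : convect (w t) (w t) (y + EuclideanSpace.single j 1) = convect (w t) (w t) y := by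
      simp only [convect_apply]
      rw [hperj t ht j y, ← fderiv_comp_add_right (EuclideanSpace.single j (1 : ℝ)), hfun]
    have h3 : timeDerivWithin (Ioo t₀ 0) w t (y + EuclideanSpace.single j 1) =
        timeDerivWithin (Ioo t₀ 0) w t y := by
      simp only [timeDerivWithin_apply]
      exact derivWithin_congr (fun τ hτ => hperj τ hτ j y) (hperj t ht j y)
    rw [hmomR t ht, hmomR t ht, h1, h2, h3]
  -- hence the periods of the pressure are constant in space
  have hpt_diff : ∀ t ∈ Ioo t₀ (0 : ℝ), Differentiable ℝ (p t) := fun t ht =>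
    (hcl.smooth_pressure.contDiff_slice ht).differentiable (by simp)
  have hcj : ∀ t ∈ Ioo t₀ (0 : ℝ), ∀ (j : Fin 3) (y : EuclideanSpace ℝ (Fin 3)),
      p t (y + EuclideanSpace.single j 1) - p t y = p t (EuclideanSpace.single j 1) - p t 0 := by
    intro t ht j y
    have hd1 : Differentiable ℝ fun x => p t (x + EuclideanSpace.single j 1) :=
      (hpt_diff t ht).comp (differentiable_id.add_const _)
    have hd : Differentiable ℝ fun x => p t (x + EuclideanSpace.single j 1) - p t x :=
      hd1.sub (hpt_diff t ht)
    have hzero : ∀ x, fderiv ℝ (fun x => p t (x + EuclideanSpace.single j 1) - p t x) x = 0 := by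
      intro x
      rw [fderiv_fun_sub (hd1 x) (hpt_diff t ht x), fderiv_comp_add_right, sub_eq_zero]
      have hg := hgradper t ht j x
      simp only [gradient] at hg
      exact (InnerProductSpace.toDual ℝ (EuclideanSpace ℝ (Fin 3))).symm.injective hg
    have := is_const_of_fderiv_eq_zero hd hzero y 0
    simpa using this
  -- the linear part of the pressure and the periodic remainder
  set c : ℝ → Fin 3 → ℝ := fun t j => p t (EuclideanSpace.single j 1) - p t 0 with hcdef
  set cv : ℝ → EuclideanSpace ℝ (Fin 3) := fun t => ∑ j, c t j • EuclideanSpace.single j (1 : ℝ)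
    with hcvdef
  have hcv_inner : ∀ (t : ℝ) (j : Fin 3), ⟪cv t, EuclideanSpace.single j 1⟫ = c t j := by
    intro t j
    have hon := (EuclideanSpace.basisFun (Fin 3) ℝ).orthonormal.inner_left_fintype (c t) j
    simpa [EuclideanSpace.basisFun_apply, hcvdef] using hon
  set θ : ℝ → EuclideanSpace ℝ (Fin 3) → ℝ := fun t y => p t y - ⟪cv t, y⟫ with hθdef
  have hθper : ∀ t ∈ Ioo t₀ (0 : ℝ), Torus.IsLatticePeriodic (θ t) := by
    intro t ht j y
    simp only [hθdef, inner_add_right, hcv_inner]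
    have := hcj t ht j y
    linarith
  have hθgrad : ∀ t ∈ Ioo t₀ (0 : ℝ), ∀ y, gradient (θ t) y = gradient (p t) y - cv t := by
    intro t ht y
    have hp' : HasFDerivAt (p t)
        (InnerProductSpace.toDual ℝ (EuclideanSpace ℝ (Fin 3)) (gradient (p t) y)) y :=
      (hpt_diff t ht y).hasGradientAt
    have hi' : HasFDerivAt (fun y : EuclideanSpace ℝ (Fin 3) => ⟪cv t, y⟫)
        (InnerProductSpace.toDual ℝ (EuclideanSpace ℝ (Fin 3)) (cv t)) y :=
      hasGradientAt_inner_const_left (cv t) y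
    have hθ' : HasGradientAt (θ t) (gradient (p t) y - cv t) y := by
      rw [hasGradientAt_iff_hasFDerivAt, map_sub]
      exact hp'.sub hi'
    exact hθ'.gradient
  -- smoothness of the new pressure and of the force
  have hcvs : ContDiffOn ℝ ∞ (fun q : ℝ × EuclideanSpace ℝ (Fin 3) => cv q.1) (Ioo t₀ 0 ×ˢ univ) := by
    have hpj : ∀ z : EuclideanSpace ℝ (Fin 3),
        ContDiffOn ℝ ∞ (fun q : ℝ × EuclideanSpace ℝ (Fin 3) => p q.1 z) (Ioo t₀ 0 ×ˢ univ) := by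
      intro z
      have hι : ContDiff ℝ ∞
          (fun q : ℝ × EuclideanSpace ℝ (Fin 3) => ((q.1, z) : ℝ × EuclideanSpace ℝ (Fin 3))) :=
        contDiff_fst.prodMk contDiff_const
      exact hcl.smooth_pressure.comp hι.contDiffOn fun q hq => ⟨(mem_prod.1 hq).1, mem_univ _⟩
    simp only [hcvdef, hcdef]
    exact ContDiffOn.sum fun j _ => ((hpj _).sub (hpj _)).smul contDiffOn_const
  have hθs : IsSmoothSpaceTimeOn (Ioo t₀ 0) θ := by
    have h1 : ContDiffOn ℝ ∞ (fun q : ℝ × EuclideanSpace ℝ (Fin 3) => ⟪cv q.1, q.2⟫)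
        (Ioo t₀ 0 ×ˢ univ) :=
      hcvs.inner ℝ contDiffOn_snd
    exact hcl.smooth_pressure.sub h1
  -- the whole-space system with the constant force `-c(t)` and the periodic pressure `θ`
  have hR3 : IsClassicalNSSolutionOn (Ioo t₀ 0) 1
      (fun (t : ℝ) (_ : EuclideanSpace ℝ (Fin 3)) => -cv t) w θ :=
    { smooth_velocity := hcl.smooth_velocity
      smooth_pressure := hθs
      momentum := fun t ht y => by
        have h1 := hcl.momentum t ht y
        simp only [Pi.zero_apply, add_zero] at h1
        rw [h1, hθgrad t ht y]
        abel
      divFree := hcl.divFree }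
  -- all data are periodic lifts: descend to the torus
  set Θ : ℝ → UnitAddTorus (Fin 3) → ℝ := fun t x => θ t (Torus.repr x) with hΘdef
  set fT : ℝ → UnitAddTorus (Fin 3) → EuclideanSpace ℝ (Fin 3) := fun t _ => -cv t with hfTdef
  have hΘlift : ∀ t ∈ Ioo t₀ (0 : ℝ), Torus.lift (Θ t) = θ t := fun t ht =>
    Torus.lift_descend_holds (θ t) (hθper t ht)
  have hR3' : IsClassicalNSSolutionOn (Ioo t₀ 0) 1 (fun t => Torus.lift (fT t))
      (fun t => Torus.lift (V t)) (fun t => Torus.lift (Θ t)) := by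
    have h1 : IsClassicalNSSolutionOn (Ioo t₀ 0) 1 (fun t => Torus.lift (fT t)) w θ := hR3
    exact (h1.congr_velocity fun t ht => hVlift t ht.2).congr_pressure hΘlift
  have hT : Torus.IsClassicalNSSolutionOn (Ioo t₀ 0) 1 fT V Θ :=
    IsClassicalNSSolutionOn.to_torus_holds hR3'
  -- the torus mean is the cell mean, which vanishes: so `c ≡ 0`
  have hmeanV : ∀ t ∈ Ioo t₀ (0 : ℝ), ∫ x, V t x = 0 := by
    intro t ht
    rw [Torus.integral_eq_integral_lift_holds (V t), hVlift t ht.2]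
    exact hmean t ht.2
  have hc0 : ∀ t ∈ Ioo t₀ (0 : ℝ), cv t = 0 := by
    intro t ht
    have hd' := hT.hasDerivWithinAt_integral_velocity (convex_Ioo t₀ 0) ht
    have hconst : HasDerivWithinAt (fun s : ℝ => ∫ x, V s x) 0 (Ioo t₀ 0) t :=
      (hasDerivWithinAt_const t (Ioo t₀ 0) (0 : EuclideanSpace ℝ (Fin 3))).congr
        (fun s hs => hmeanV s hs) (hmeanV t ht)
    have heq := (hSU t ht).eq_deriv _ hd' hconst
    have hint : ∫ x : UnitAddTorus (Fin 3), fT t x = -cv t := by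
      simp only [hfTdef, integral_const, probReal_univ, one_smul]
    rw [hint] at heq
    exact neg_eq_zero.1 heq
  -- the unforced torus system on `(t₀, 0)`
  refine ⟨Θ,
    { smooth_velocity := hT.smooth_velocity
      smooth_pressure := hT.smooth_pressure
      momentum := fun t ht x => by
        have h1 := hT.momentum t ht x
        simp only [hfTdef, hc0 t ht, neg_zero, add_zero] at h1
        simp only [Pi.zero_apply, add_zero]
        exact h1
      divFree := hT.divFree }⟩

/-! ## §3 The periodic sieve -/

/-- **THE SPATIALLY PERIODIC SIEVE for print's class P** (KNSS Liouville (L), stmt-10661, periodic stratum):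
a bounded ancient mild solution (continuous and bounded on `(−∞,0) × ℝ³`, weakly divergence-free slices,
Oseen integral equation) whose every slice is `ℤ³`-periodic is ONE CONSTANT VECTOR.  Proof: boost by the
conserved cell mean `m` (`TypeILiouvilleLatticeMomentum.classP_cellMean_eq_of_isLatticePeriodic`,
`Theorems.stub_oseen_const_boost`) to a periodic member `w` with zero cell mean; on every window `(t₀,0)` its
torus reading is an unforced classical solution (`classP_torus_unforced_of_isLatticePeriodic_zeroMean`), whose
energy decays like `e^{−8π²(t−s)}` (`torus_kineticEnergy_decay_of_zeroMean`); letting `s → −∞` against the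
uniform bound gives zero energy, so `w ≡ 0`, i.e. `v ≡ m`. [cite: KochNadirashviliSereginSverak2009, §4 p. 8 and Remark 6.1 (arXiv:0709.3599)] -/
theorem classP_const_of_isLatticePeriodic
    {v : ℝ → EuclideanSpace ℝ (Fin 3) → EuclideanSpace ℝ (Fin 3)}
    (hc : ContinuousOn (uncurry v) (Iio 0 ×ˢ univ))
    (hK : ∃ K : ℝ, ∀ t < 0, ∀ x, ‖v t x‖ ≤ K)
    (hd : ∀ t < 0, IsWeaklyDivFree (v t))
    (hm : ∀ s t : ℝ, s < t → t < 0 → ∀ x,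
      v t x = UnboundedOperators.heatExtension (v s) (t - s) x - oseenDuhamel 1 s v v t x)
    (hper : ∀ t < 0, Torus.IsLatticePeriodic (v t)) :
    ∃ b : EuclideanSpace ℝ (Fin 3), ∀ t < 0, ∀ x, v t x = b := by
  -- the conserved cell mean
  set m : EuclideanSpace ℝ (Fin 3) := ∫ x in Torus.unitCube (Fin 3), v (-1) x with hmdef
  have hmean : ∀ t < 0, ∫ x in Torus.unitCube (Fin 3), v t x = m := fun t ht =>
    classP_cellMean_eq_of_isLatticePeriodic hc hK hm hper (by norm_num) ht
  obtain ⟨K, hKb⟩ := hK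
  have hslice : ∀ τ < 0, Continuous (v τ) := fun τ hτ =>
    hc.comp_continuous (f := fun x : EuclideanSpace ℝ (Fin 3) => (τ, x)) (by fun_prop)
      fun x => ⟨hτ, mem_univ _⟩
  -- the Galilean boost to zero cell mean
  set w : ℝ → EuclideanSpace ℝ (Fin 3) → EuclideanSpace ℝ (Fin 3) := fun t y => v t (y + t • m) - m
    with hwdef
  obtain ⟨hwc, hwK, hwd, hwm⟩ := Theorems.stub_oseen_const_boost v m hc ⟨K, hKb⟩ hd hm
  have hwper : ∀ t < 0, Torus.IsLatticePeriodic (w t) := by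
    intro t ht j y
    simp only [hwdef]
    rw [add_right_comm, hper t ht j]
  have hwmean : ∀ t < 0, ∫ x in Torus.unitCube (Fin 3), w t x = 0 := by
    intro t ht
    have hQfin : volume (Torus.unitCube (Fin 3)) ≠ ⊤ := by
      rw [volume_unitCube]; exact ENNReal.one_ne_top
    have hcs : Continuous fun y => v t (y + t • m) := (hslice t ht).comp (continuous_id.add continuous_const)
    have hi1 : IntegrableOn (fun y => v t (y + t • m)) (Torus.unitCube (Fin 3)) volume :=
      Measure.integrableOn_of_bounded (M := K) hQfin hcs.aestronglyMeasurable
        (ae_of_all _ fun x => hKb t ht _)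
    have hi2 : IntegrableOn (fun _ : EuclideanSpace ℝ (Fin 3) => m) (Torus.unitCube (Fin 3)) volume :=
      integrableOn_const hQfin
    simp only [hwdef]
    rw [integral_sub hi1 hi2, setIntegral_unitCube_comp_add_right (hper t ht) (t • m), hmean t ht,
      setIntegral_const, volume_real_unitCube, one_smul, sub_self]
  -- the torus reading of `w`
  set W : ℝ → UnitAddTorus (Fin 3) → EuclideanSpace ℝ (Fin 3) := fun t x => w t (Torus.repr x) with hWdef
  have hWlift : ∀ t < 0, Torus.lift (W t) = w t := fun t ht => Torus.lift_descend_holds (w t) (hwper t ht)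
  have hW0 : ∀ t < 0, Torus.HasZeroMean (W t) := by
    intro t ht
    show ∫ x, W t x = 0
    rw [Torus.integral_eq_integral_lift_holds (W t), hWlift t ht]
    exact hwmean t ht
  obtain ⟨K', hK'⟩ := hwK
  have hK'0 : 0 ≤ K' := (norm_nonneg _).trans (hK' (-1) (by norm_num) 0)
  have hWb : ∀ t < 0, ∀ x, ‖W t x‖ ≤ K' := fun t ht x => hK' t ht _
  -- energy bound on every slice
  have hEb : ∀ s < 0, Torus.kineticEnergy (W s) ≤ 2⁻¹ * K' ^ 2 := by
    intro s hs
    have hWc : Continuous (W s) := by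
      rw [← Torus.continuous_lift_iff, hWlift s hs]
      exact (hwc.comp_continuous (f := fun x : EuclideanSpace ℝ (Fin 3) => (s, x)) (by fun_prop)
        fun x => ⟨hs, mem_univ _⟩)
    have hi : Integrable (fun x => ‖W s x‖ ^ 2) volume :=
      (hWc.norm.pow 2).integrable_unitAddTorus
    have hle : ∫ x, ‖W s x‖ ^ 2 ≤ ∫ _x : UnitAddTorus (Fin 3), K' ^ 2 := by
      refine integral_mono hi (integrable_const _) fun x => ?_
      have := hWb s hs x
      exact pow_le_pow_left₀ (norm_nonneg _) this 2
    rw [integral_const, probReal_univ, one_smul] at hle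
    simp only [Torus.kineticEnergy]
    linarith
  -- energy decay between any two negative times
  have hdecay : ∀ s t : ℝ, s < t → t < 0 →
      Torus.kineticEnergy (W t) ≤ 2⁻¹ * K' ^ 2 * Real.exp (-(8 * Real.pi ^ 2 * (t - s))) := by
    intro s t hst ht
    have ht₀ : s - 1 < 0 := by linarith
    obtain ⟨Θ, hT⟩ := classP_torus_unforced_of_isLatticePeriodic_zeroMean hwc ⟨K', hK'⟩ hwd hwm hwper
      hwmean ht₀
    have hsS : s ∈ Ioo (s - 1) (0 : ℝ) := ⟨by linarith, by linarith⟩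
    have htS : t ∈ Ioo (s - 1) (0 : ℝ) := ⟨by linarith, ht⟩
    have h1 := torus_kineticEnergy_decay_of_zeroMean hT zero_le_one (convex_Ioo _ _)
      (fun τ hτ => hW0 τ hτ.2) hsS htS hst.le
    rw [mul_one] at h1
    exact h1.trans (mul_le_mul_of_nonneg_right (hEb s (by linarith)) (Real.exp_nonneg _))
  -- letting `s → -∞`: zero energy on every slice
  have hE0 : ∀ t < 0, Torus.kineticEnergy (W t) = 0 := by
    intro t ht
    refine le_antisymm ?_ (Torus.kineticEnergy_nonneg _)
    have hlim : Tendsto (fun s : ℝ => 2⁻¹ * K' ^ 2 * Real.exp (-(8 * Real.pi ^ 2 * (t - s))))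
        atBot (𝓝 0) := by
      have h1 : Tendsto (fun s : ℝ => 8 * Real.pi ^ 2 * s - 8 * Real.pi ^ 2 * t) atBot atBot :=
        tendsto_atBot_add_const_right _ _ (tendsto_id.const_mul_atBot (by positivity))
      have h2 := Real.tendsto_exp_atBot.comp h1
      have h3 := h2.const_mul (2⁻¹ * K' ^ 2)
      rw [mul_zero] at h3
      refine h3.congr fun s => ?_
      simp only [Function.comp_apply]
      congr 1; congr 1; ring
    refine ge_of_tendsto hlim ?_
    filter_upwards [eventually_lt_atBot t] with s hs
    exact hdecay s t hs ht
  -- hence `w ≡ 0`, i.e. `v ≡ m`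
  refine ⟨m, fun t ht x => ?_⟩
  have hWc : Continuous (W t) := by
    rw [← Torus.continuous_lift_iff, hWlift t ht]
    exact (hwc.comp_continuous (f := fun x : EuclideanSpace ℝ (Fin 3) => (t, x)) (by fun_prop)
      fun x => ⟨ht, mem_univ _⟩)
  have hi : Integrable (fun x => ‖W t x‖ ^ 2) volume := (hWc.norm.pow 2).integrable_unitAddTorus
  have hint0 : ∫ x, ‖W t x‖ ^ 2 = 0 := by
    have := hE0 t ht
    simp only [Torus.kineticEnergy] at this
    simpa using this
  have hae : (fun x => ‖W t x‖ ^ 2) =ᵐ[volume] 0 :=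
    (integral_eq_zero_iff_of_nonneg (fun x => by positivity) hi).1 hint0
  have hzero : (fun x => ‖W t x‖ ^ 2) = 0 :=
    (Continuous.ae_eq_iff_eq volume (hWc.norm.pow 2) continuous_const).1 hae
  have hWt : ∀ y, W t y = 0 := by
    intro y
    have := congr_fun hzero y
    simpa using this
  have hwt : w t (x - t • m) = 0 := by
    have h1 := congr_fun (hWlift t ht) (x - t • m)
    rw [Torus.lift_apply] at h1
    rw [← h1]
    exact hWt _
  have : v t x - m = 0 := by
    simpa [hwdef, sub_add_cancel] using hwt
  exact (sub_eq_zero.1 this)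

end Summit.NavierStokesRegularity.NavierStokesRegularity.Theorems.TypeILiouvilleLatticeMomentum

end
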